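import Mathlib
import Summits.KontsevichZagierPeriods.Zeta5Search.RecordRayDominanceProof
import Summits.KontsevichZagierPeriods.Zeta5Search.CasoratianClassBoundProof
import Summits.KontsevichZagierPeriods.Zeta5Search.DenomLaw.PathWeightProfile
import HarnessLib

/-!
# ζ(5) search — the record ray's cells `13n < p < 14n` (every class has `E_x ≥ −4`, `casLB ≥ −5` sharp, `C⋆ ≤ 8`) and `12.5n < p ≤ 13n` (`C⋆ ≤ 9`), and the PATH node there

Cell `pub-zeta5` (HONEST FRAMING: systematic search; no irrationality claim unless certified), TRACK «DENOM-LAW» D1 prover seat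
(denom-prover-d1 g11, `HOME/denom-law/prover-d1/ATTEMPT-11.md` §8).  On Brown–Zudilin's record ray `b(n) = n·(41;17,…,11)` and `13n < p < 14n`
(`x < p`, class `{x, x+p, x+2p, (x+3p)}`): the depth bookkeeping of `RecordRayDominanceProof` §1 sharpened by one unit (`x + 2p > 26n` now) gives
`E_x ≥ −4` for EVERY class (sharp: `x + p ∈ [17n,24n]`), hence `casLB(b(n),p) ≥ −5` (`VB ≥ −4`, rows `≥ −1`; the census value on the cell), and with
THEOREM LB (`casoratianClassBound_holds`) `v_p(Cas_j(b(n))) ≥ −5`.  The PATH ACCOUNTING node's value on the cell is `1 − 9 − min(0, 5 − C⋆)` with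
`C⋆ ≤ 8` (`cStar_le_of_profile`: longs among `17n,…,14n`, heavy pair blocks `i + k ≥ 7`; attained), i.e. `≤ −5`: so `PathAccountingFirstPeriod`'s
literal conclusion holds on this cell too (`pathAccounting_bRec_cell1314`); on `12.5n < p ≤ 13n` the same with `casLB ≥ −7`
(`RecordRayMid14.casLB_ge14`), `N_p = 12`, `C⋆ ≤ 9` (`pathAccounting_bRec_cell1213`).  Integer bookkeeping; nothing about irrationality.
-/

open Finset

namespace Summit.KontsevichZagierPeriods.Zeta5Search.RecordRay1314

open Summit.KontsevichZagierPeriods.Zeta5Search.ClusterValuation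
open Summit.KontsevichZagierPeriods.Zeta5Search.CasoratianValuation (InPolytope pairFloors refund shift casoratian)
open Summit.KontsevichZagierPeriods.Zeta5Search.WedgeDictionary (dOf)
open Summit.KontsevichZagierPeriods.Zeta5Search.CellA
open Summit.KontsevichZagierPeriods.Zeta5Search.RecordRayTop (self_mem_class add_mem_class)
open Summit.KontsevichZagierPeriods.Zeta5Search.RecordRayMid14 (dep7_le_low dep7_le_high netExp_ge mem_class_cases4 mem2 classExp_ge_sub
  pairFloors_bRec_mid)
open Summit.KontsevichZagierPeriods.Zeta5Search.DenomLaw (cStar)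
open Summit.KontsevichZagierPeriods.Zeta5Search.DenomLaw.FirstPeriodKit (cStar_le_of_profile bRec_param bRec_block)

/-- On the record ray `⌊d/p⌋ = ⌊25n/p⌋ ≤ 1` once `25n < 2p` (i.e. for `p > 12.5n`). -/
theorem dOf_bRec_div_le_one {n p : ℕ} (hp : 25 * n < 2 * p) : dOf (bRec n) / (p : ℤ) ≤ 1 := by
  rw [dOf_bRec]
  have hp0 : (0 : ℤ) < p := by exact_mod_cast (show 0 < p by omega)
  have : (25 * (n : ℤ)) / (p : ℤ) < 2 := by
    rw [Int.ediv_lt_iff_lt_mul hp0]; omega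
  omega

section Cell

variable {n p x : ℕ} (hp13 : 13 * n < p) (hp14 : p < 14 * n) (hx : x < p)

include hp13 hp14 hx in
/-- **Every class has `E_x ≥ −4`** for `13n < p < 14n`. -/
theorem classExp_ge_neg4 : (-4 : ℤ) ≤ classExp (bRec n) p x := by
  have hp12 : 12 * n < p := by omega
  have hv41 : x + p ≤ 41 * n := by omega
  have gx := netExp_ge n x
  have gv := netExp_ge n (x + p)
  have gw := netExp_ge n (x + 2 * p)
  have d1le := dep7_le n (x + p)
  -- the fourth point, if present, is a zero
  have hu : x + 3 * p ≤ 41 * n → 0 ≤ netExp (bRec n) (x + 3 * p) := fun h => by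
    have := netExp_ge n (x + 3 * p); have := dep7_high (n := n) (q := x + 3 * p) (by omega); omega
  -- with three points `x, x+p, x+2p ≤ 41n`: `E ≥ (1 − d₀) + (1 − d₁) + (1 − d₂)`
  have three : x + 2 * p ≤ 41 * n →
      (1 - (dep7 n x : ℤ)) + (1 - (dep7 n (x + p) : ℤ)) + (1 - (dep7 n (x + 2 * p) : ℤ)) ≤ classExp (bRec n) p x := by
    intro hw41
    have hsub : ({x, x + p, x + 2 * p} : Finset ℕ) ⊆ classSet (bRec n) p x := by
      intro s hs
      simp only [mem_insert, mem_singleton] at hs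
      rcases hs with rfl | rfl | rfl
      · exact self_mem_class (by omega) hx
      · exact add_mem_class hv41
      · exact mem2 hw41
    have hrest : ∀ s ∈ classSet (bRec n) p x, s ∉ ({x, x + p, x + 2 * p} : Finset ℕ) → 0 ≤ netExp (bRec n) s := by
      intro s hs hns
      rcases mem_class_cases4 hp12 hx hs with rfl | ⟨rfl, -⟩ | ⟨rfl, -⟩ | ⟨rfl, h3⟩
      · simp at hns
      · simp at hns
      · simp at hns
      · exact hu h3
    have hE := classExp_ge_sub ({x, x + p, x + 2 * p} : Finset ℕ) hsub hrest
    rw [sum_insert (by simp; omega), sum_pair (by omega)] at hE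
    linarith
  by_cases hx13 : x < 13 * n
  · have hw41 : x + 2 * p ≤ 41 * n := by omega
    have h3 := three hw41
    by_cases hx11 : x < 11 * n
    · have e0 : dep7 n x = 0 := dep7_low hx11
      -- `d₁ + d₂ ≤ 7` (one sharper than on `(12n,14n)`: `x + 2p > 26n`)
      have h7 : dep7 n (x + p) + dep7 n (x + 2 * p) ≤ 7 := by
        by_cases h2 : x + p < 14 * n
        · have := dep7_le_low (n := n) (q := x + p) (k := 3) (by norm_num) (by omega)
          have := dep7_le_high (n := n) (q := x + 2 * p) (k := 4) (by norm_num) (by omega)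
          omega
        by_cases h3' : x + p < 15 * n
        · have := dep7_le_low (n := n) (q := x + p) (k := 4) (by norm_num) (by omega)
          have := dep7_le_high (n := n) (q := x + 2 * p) (k := 3) (by norm_num) (by omega)
          omega
        by_cases h4 : x + p < 16 * n
        · have := dep7_le_low (n := n) (q := x + p) (k := 5) (by norm_num) (by omega)
          have := dep7_le_high (n := n) (q := x + 2 * p) (k := 2) (by norm_num) (by omega)
          omega
        by_cases h5 : x + p < 17 * n
        · have := dep7_le_low (n := n) (q := x + p) (k := 6) (by norm_num) (by omega)
          have := dep7_le_high (n := n) (q := x + 2 * p) (k := 1) (by norm_num) (by omega)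
          omega
        · have : dep7 n (x + 2 * p) = 0 := dep7_high (by omega)
          omega
      have : ((dep7 n (x + p) : ℕ) : ℤ) + ((dep7 n (x + 2 * p) : ℕ) : ℤ) ≤ 7 := by exact_mod_cast h7
      rw [e0] at h3
      push_cast at h3
      linarith
    by_cases hx12 : x < 12 * n
    · -- `x` neutral (depth ≤ 1), `x + p > 24n` has depth `≤ 6`, `x + 2p > 37n` is a zero
      have e0 := dep7_le_low (n := n) (q := x) (k := 1) (by norm_num) (by omega)
      have e1 := dep7_le_high (n := n) (q := x + p) (k := 6) (by norm_num) (by omega)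
      have e2 : dep7 n (x + 2 * p) = 0 := dep7_high (by omega)
      have : ((dep7 n x : ℕ) : ℤ) ≤ 1 := by exact_mod_cast e0
      have : ((dep7 n (x + p) : ℕ) : ℤ) ≤ 6 := by exact_mod_cast e1
      rw [e2] at h3
      push_cast at h3
      linarith
    · -- `12n ≤ x < 13n`: depth ≤ 2, `x + p > 25n` depth ≤ 5, `x + 2p` a zero
      have e0 := dep7_le_low (n := n) (q := x) (k := 2) (by norm_num) (by omega)
      have e1 := dep7_le_high (n := n) (q := x + p) (k := 5) (by norm_num) (by omega)
      have e2 : dep7 n (x + 2 * p) = 0 := dep7_high (by omega)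
      have : ((dep7 n x : ℕ) : ℤ) ≤ 2 := by exact_mod_cast e0
      have : ((dep7 n (x + p) : ℕ) : ℤ) ≤ 5 := by exact_mod_cast e1
      rw [e2] at h3
      push_cast at h3
      linarith
  · -- `13n ≤ x < p < 14n`: `x` has depth ≤ 3, `x + p > 26n`
    have e0 := dep7_le_low (n := n) (q := x) (k := 3) (by norm_num) (by omega)
    have he0 : ((dep7 n x : ℕ) : ℤ) ≤ 3 := by exact_mod_cast e0
    by_cases hw41 : x + 2 * p ≤ 41 * n
    · -- three points; `x + p` depth ≤ 4, `x + 2p > 39n` a zero worth `+1`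
      have h3 := three hw41
      have e1 := dep7_le_high (n := n) (q := x + p) (k := 4) (by norm_num) (by omega)
      have e2 : dep7 n (x + 2 * p) = 0 := dep7_high (by omega)
      have : ((dep7 n (x + p) : ℕ) : ℤ) ≤ 4 := by exact_mod_cast e1
      rw [e2] at h3
      push_cast at h3
      linarith
    · -- two points; `x + p > 27n` has depth ≤ 3
      have hsub : ({x, x + p} : Finset ℕ) ⊆ classSet (bRec n) p x := by
        intro s hs
        simp only [mem_insert, mem_singleton] at hs
        rcases hs with rfl | rfl
        · exact self_mem_class (by omega) hx
        · exact add_mem_class hv41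
      have hrest : ∀ s ∈ classSet (bRec n) p x, s ∉ ({x, x + p} : Finset ℕ) → 0 ≤ netExp (bRec n) s := by
        intro s hs hns
        rcases mem_class_cases4 hp12 hx hs with rfl | ⟨rfl, -⟩ | ⟨rfl, h2⟩ | ⟨rfl, h3⟩
        · simp at hns
        · simp at hns
        · omega
        · exact hu h3
      have hE := classExp_ge_sub ({x, x + p} : Finset ℕ) hsub hrest
      rw [sum_pair (by omega)] at hE
      have e1 := dep7_le_high (n := n) (q := x + p) (k := 3) (by norm_num) (by omega)
      have : ((dep7 n (x + p) : ℕ) : ℤ) ≤ 3 := by exact_mod_cast e1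
      linarith

end Cell

/-- **`casLB(b(n),p) ≥ −5`** for `13n < p < 14n` (`VB ≥ −4`, rows `≥ −1`; the census value of the cell). -/
theorem casLB_ge1314 {n p : ℕ} (hp13 : 13 * n < p) (hp14 : p < 14 * n) : -5 ≤ casLB (bRec n) p := by
  rcases casLB_ge_or_noPole (bRec n) p (-4) (-1)
      (fun x hx _ => (classExp_ge_neg4 hp13 hp14 hx).trans (classExp_le_classNu _ _ _)) (by norm_num)
      (fun x hx _ => by linarith [classExp_ge_neg4 hp13 hp14 hx]) (fun _ => by norm_num) with ⟨h0, -⟩ | h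
  · rw [h0]; norm_num
  · linarith

/-- **`v_p(Cas_j(b(n))) ≥ −5`** on `13n < p < 14n` (THEOREM LB). -/
theorem cas_ge_neg5 (n j p : ℕ) (hn : 1 ≤ n) (hj1 : 1 ≤ j) (hj7 : j ≤ 7) (hprime : p.Prime) (hp13 : 13 * n < p) (hp14 : p < 14 * n)
    (hwin : (41 * n + 2 : ℤ) < (p : ℤ) ^ 2) (hcas : casoratian (bRec n) j ≠ 0) :
    (-5 : ℤ) ≤ padicValRat p (casoratian (bRec n) j) := by
  have hb0 : (bRec n 0 + 2 : ℤ) < (p : ℤ) ^ 2 := by rw [bRec_zero]; exact_mod_cast hwin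
  have h := casoratianClassBound_holds (bRec n) j p (inPolytope_bRec n) hj1 hj7
    (inPolytope_shift_bRec n j hn hj1 hj7) hprime (by omega) hb0 hcas
  linarith [casLB_ge1314 hp13 hp14]

/-- **`C⋆ ≤ 8` on the record cell `13n < p`** (longs among `17n,…,14n`; heavy pair blocks `i + k ≥ 7`; attained on `13n < p < 14n`). -/
theorem cStar_bRec_le_eight {n p : ℕ} (hp : 13 * n < p) : cStar (bRec n) p ≤ 8 := by
  refine cStar_le_of_profile (fun i : Fin 7 => i.val ≤ 3) (fun i k : Fin 7 => 7 ≤ i.val + k.val) 8 ?_ ?_ (by decide +kernel)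
  · intro i hi
    rw [bRec_param] at hi
    by_contra hc
    push Not at hc
    have h4 : (4 : ℤ) ≤ i.val := by exact_mod_cast hc
    nlinarith
  · intro i k hik
    rw [bRec_block] at hik
    by_contra hc
    push Not at hc
    have h6 : (i.val : ℤ) + k.val ≤ 6 := by exact_mod_cast (by omega : i.val + k.val ≤ 6)
    nlinarith

/-- **PATH on the record cell `13n < p < 14n`**: `⌊d/p⌋ = 1`, `N_p = 9`, `C⋆ ≤ 8`, so the node's value is `≤ 1 − 9 + 3 = −5 ≤ v_p(Cas₇)`. -/
theorem pathAccounting_bRec_cell1314 (n p : ℕ) (hn : 1 ≤ n) (hprime : p.Prime) (hp13 : 13 * n < p) (hp14 : p < 14 * n)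
    (hwin : (41 * n + 2 : ℤ) < (p : ℤ) ^ 2) (hcas : casoratian (bRec n) 7 ≠ 0) :
    dOf (bRec n) / (p : ℤ) - pairFloors (bRec n) p
        - min (if 2 ≤ dOf (bRec n) / (p : ℤ) then (1 : ℤ) else 0) (5 - (cStar (bRec n) p : ℤ))
      ≤ padicValRat p (casoratian (bRec n) 7) := by
  have hv := cas_ge_neg5 n 7 p hn (by norm_num) (by norm_num) hprime hp13 hp14 hwin hcas
  have hC : (cStar (bRec n) p : ℤ) ≤ 8 := by exact_mod_cast cStar_bRec_le_eight hp13
  have hfd := dOf_bRec_div_le_one (n := n) (p := p) (by omega)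
  have hN : pairFloors (bRec n) p = 9 := by
    rw [pairFloors_bRec_mid (by omega), if_neg (by omega), if_pos (by omega), if_pos (by omega), if_pos (by omega),
      if_pos (by omega), if_pos (by omega)]
    norm_num
  rw [if_neg (by omega), hN]
  have hmin : -3 ≤ min (0 : ℤ) (5 - (cStar (bRec n) p : ℤ)) := le_min (by norm_num) (by linarith)
  linarith

/-! ## The cell `12.5n < p ≤ 13n`: `casLB ≥ −7` (RecordRayDominanceProof §1), `C⋆ ≤ 9`, and the PATH node there -/

/-- **`C⋆ ≤ 9` on the record ray for `12n < p`** (longs among `17n,…,13n`; heavy pair blocks `i + k ≥ 6`; attained on `12.5n < p ≤ 13n`). -/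
theorem cStar_bRec_le_nine {n p : ℕ} (hp : 12 * n < p) : cStar (bRec n) p ≤ 9 := by
  refine cStar_le_of_profile (fun i : Fin 7 => i.val ≤ 4) (fun i k : Fin 7 => 6 ≤ i.val + k.val) 9 ?_ ?_ (by decide +kernel)
  · intro i hi
    rw [bRec_param] at hi
    by_contra hc
    push Not at hc
    have h5 : (5 : ℤ) ≤ i.val := by exact_mod_cast hc
    nlinarith
  · intro i k hik
    rw [bRec_block] at hik
    by_contra hc
    push Not at hc
    have h5 : (i.val : ℤ) + k.val ≤ 5 := by exact_mod_cast (by omega : i.val + k.val ≤ 5)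
    nlinarith

/-- **PATH on the record cell `12.5n < p ≤ 13n`**: `⌊d/p⌋ = 1`, `N_p = 12`, `C⋆ ≤ 9`, so the node's value is `≤ 1 − 12 + 4 = −7 ≤ casLB ≤ v_p(Cas₇)`
(`RecordRayMid14.casLB_ge14` + THEOREM LB). -/
theorem pathAccounting_bRec_cell1213 (n p : ℕ) (hn : 1 ≤ n) (hprime : p.Prime) (hp25 : 25 * n < 2 * p) (hp13 : p ≤ 13 * n)
    (hwin : (41 * n + 2 : ℤ) < (p : ℤ) ^ 2) (hcas : casoratian (bRec n) 7 ≠ 0) :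
    dOf (bRec n) / (p : ℤ) - pairFloors (bRec n) p
        - min (if 2 ≤ dOf (bRec n) / (p : ℤ) then (1 : ℤ) else 0) (5 - (cStar (bRec n) p : ℤ))
      ≤ padicValRat p (casoratian (bRec n) 7) := by
  have hb0 : (bRec n 0 + 2 : ℤ) < (p : ℤ) ^ 2 := by rw [bRec_zero]; exact_mod_cast hwin
  have hLB := casoratianClassBound_holds (bRec n) 7 p (inPolytope_bRec n) (by norm_num) (by norm_num)
    (inPolytope_shift_bRec n 7 hn (by norm_num) (by norm_num)) hprime (by omega) hb0 hcas
  have h7 := RecordRayMid14.casLB_ge14 (n := n) (p := p) (by omega) (by omega)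
  have hC : (cStar (bRec n) p : ℤ) ≤ 9 := by exact_mod_cast cStar_bRec_le_nine (n := n) (p := p) (by omega)
  have hfd := dOf_bRec_div_le_one (n := n) (p := p) hp25
  have hN : pairFloors (bRec n) p = 12 := by
    rw [pairFloors_bRec_mid (by omega), if_pos (by omega), if_pos (by omega), if_pos (by omega), if_pos (by omega),
      if_pos (by omega), if_pos (by omega)]
    norm_num
  rw [if_neg (by omega), hN]
  have hmin : -4 ≤ min (0 : ℤ) (5 - (cStar (bRec n) p : ℤ)) := le_min (by norm_num) (by linarith)
  linarith

end Summit.KontsevichZagierPeriods.Zeta5Search.RecordRay1314
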